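/-
line stmt-HodgeConjecture-18881 Cruxes/BlochSeedDiscOne/Lines/birth.lean 814a6a70c14e831a stub_rung_pad4_seedAt
U-EXIST (hsemireg-alphabet-unipotent-1, g26) — ARITHMETIC PLATE ONLY.
Nothing here is proved toward HC / HC_CM / HC_AV / №4 / 26512 / 18881 / H2; the stub is untouched.
CLASS ≠ DESIGN ≠ SHEAF ≠ SEED.  This file certifies the bookkeeping arithmetic quoted in
`g26/memo/U-EXIST-unipotent1-g26.md` (carving identities of RULE U-TGT★, the rank identity of the
count-scaled table, the mass-universal cap `ub` of the relaxation E2 and its vanishing criterion, the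
co-mass slack count, and the logical form «a witness checked on every stratum decides EXISTS»).  It does not certify the engine.
Mathlib only; no `sorry`, no `instance`, no `notation`, no unsafe options.
-/
import Mathlib

namespace HsemiregAlphabet.UnipotentExistArith

/-! ## 1. Carving identities of U-TGT★ (every retyped cell keeps its rank = mass · s, here s = 1) -/

/-- fam48 cell (mass 176 695): F4T letter `arc_{176695}` carved into `arc_2 ⊕ arc_{176693}` (1 class, 1 copy). -/
theorem fam48_carve : 176695 = 2 * 1 + 176693 := by norm_num

/-- fam16a cell (mass 4 060): F4T letter `arc_{4060}` carved into five `arc_2` copies and `arc_{4050}`. -/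
theorem fam16a_carve : 4060 = 2 * 5 + 4050 := by norm_num

/-- fam16b cell (mass 435 462 = three F4Tb arcs of length 20 160 on the (11,∓1,0)-factors and one F4Tb arc of
length 374 982 on the (12,0,0)-factor): the three `arc_2` copies (one per (11,∓1,0)-factor class) are carved
from the longest arc. -/
theorem fam16b_carve : 435462 = 3 * 20160 + 374982 ∧ 374982 = 2 * 3 + 374976 := by norm_num

/-- the big LINE dead-end cells of mass 81 464 (`N[[9,∓3,0],[12,0,0]^3]` and permutations): six classes
on the three (12,0,0)-factors, 2 + 1 copies per factor (extra D), nine `arc_2` copies in all. -/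
theorem c81464_carve : 3 * (2 + 1) = 9 ∧ 81464 = 2 * 9 + 81446 := by norm_num

/-- corridor targets (extra C): a rank-2 LINE dead-end cell becomes one `arc_2`. -/
theorem corridor_tgt_carve : 2 = 2 * 1 + 0 := by norm_num

/-- the number of U-TGT★ cells by kind: fam48 + fam16a + mass-81464 + fam16b + corridor targets +
corridor sources of mass 81 467 + corridor sources of mass 134 832. -/
theorem utgt_cell_count : 48 + 16 + 16 + 16 + 32 + 16 + 16 = 160 := by norm_num

/-! ## 2. The co-mass near-tightness behind the corridors
The LINE source `A[[6,∓6,0],[12,0,0]^3]` (mass 81 467) has exactly four exits, of masses 81 464 (the big dead-end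
cell on its special factor), 8 (the hub), 2 and 2: raw slack 9, with the hub and the two rank-2 cells contested
by other sources.  One-sided target typing of the 81 464-cell on its (12,0,0)-factors costs one unit of generic
capacity per `arc_2` copy on this block (pt → arc₂ across a zero step reaches only the socle); nine copies plus
the contested exits overshoot the slack (variant T1: Σ = ∅ deficit 168), whence MATCHED arcs (arc₂ → arc₂
across a zero step is an isomorphism) — corridor D. -/
theorem comass_slack : 81464 + 8 + 2 + 2 = 81467 + 9 := by norm_num

/-- the corridor sources after C and D: the 81 467-cell carries 1 + 9 unit arcs, the 134 832-cell
(`A[[4,0,∓4],[8,0,0]^3]` and kin) carries 12 (one per (factor ≠ special, unit direction)); both stay mostly LINE. -/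
theorem corridor_src_carve : 81467 = 2 * (1 + 9) + 81447 ∧ 134832 = 2 * 12 + 134808 := by norm_num

/-! ## 3. Count scaling: the s = 2 table is two copies of the s = 1 atoms -/

/-- rank identity of the count-scaled table: a cell of mass `m` typed at s = 1 by atoms of total length `m`
has total length `m * s` when every multiplicity is multiplied by `s`. -/
theorem count_scaled_rank {k : ℕ} (m s : ℕ) (mult : Fin k → ℕ) (len : Fin k → ℕ)
    (h : ∑ i, mult i * len i = m) : ∑ i, (s * mult i) * len i = m * s := by
  have : ∑ i, (s * mult i) * len i = s * ∑ i, mult i * len i := by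
    rw [Finset.mul_sum]; refine Finset.sum_congr rfl ?_; intro i _; ring
  rw [this, h]; ring

/-- positive homogeneity: a deficit functional that scales exactly with the multiplicity factor vanishes at
every `s ≥ 1` iff it vanishes at s = 1 (the engine's flow bounds are homogeneous in multiplicities). -/
theorem homogeneous_deficit_zero_iff (d : ℕ → ℕ) (hd : ∀ s, d s = s * d 1) {s : ℕ} (hs : 1 ≤ s) :
    d s = 0 ↔ d 1 = 0 := by
  rw [hd s]; constructor
  · intro h; rcases Nat.mul_eq_zero.mp h with h | h
    · omega
    · exact h
  · intro h; simp [h]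

/-! ## 4. The mass-universal cap of relaxation E2 (`--cap ub`)
For a W₁-killed block between cells of ranks `ra`, `rn` the engine's LEMMA-T capacity of ANY pair of
typings is at most `ub ra rn := min ra rn − [ra = 1 ∧ rn = 1]`; unkilled blocks are capped by `min ra rn`.
A stratum failing under `ub` therefore fails for every table; the converse is false (E2 is one-sided). -/

/-- the universal cap. -/
def ub (ra rn : ℕ) : ℕ := min ra rn - if ra = 1 ∧ rn = 1 then 1 else 0

theorem ub_le_min (ra rn : ℕ) : ub ra rn ≤ min ra rn := by
  unfold ub; exact Nat.sub_le _ _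

/-- `ub` vanishes exactly on the 1 → 1 blocks (and the degenerate rank-0 cases): the only killed blocks that
no typing can rescue are point-to-point. -/
theorem ub_eq_zero_iff (ra rn : ℕ) : ub ra rn = 0 ↔ ra = 0 ∨ rn = 0 ∨ (ra = 1 ∧ rn = 1) := by
  unfold ub
  by_cases h : ra = 1 ∧ rn = 1
  · simp [h]
  · rw [if_neg h]; simp only [Nat.sub_zero]; omega

/-- monotonicity used in E2: if a table's own caps already make a stratum pass (deficit 0 with caps `c`),
then it passes under any pointwise larger caps `c'` — so tiers clean on the table need no separate UB run.
Stated for the elementary form the engine uses: a demand met by `c` is met by `c' ≥ c`. -/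
theorem pass_mono {ι : Type*} (s : Finset ι) (c c' : ι → ℕ) (demand : ℕ)
    (hle : ∀ i ∈ s, c i ≤ c' i) (h : demand ≤ ∑ i ∈ s, c i) : demand ≤ ∑ i ∈ s, c' i :=
  h.trans (Finset.sum_le_sum hle)

/-! ## 5. Logical form of the answer «EXISTS, decided by a checked witness»
`Good T σ` = table `T` passes stratum `σ`.  A witness checked on every stratum of the battery decides the
existential; representatives + invariance give «every stratum» (g25 plate `complete_of_reps`, restated). -/

theorem exists_of_witness {Table Stratum : Type*} (Good : Table → Stratum → Prop) (T : Table)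
    (h : ∀ σ, Good T σ) : ∃ T', ∀ σ, Good T' σ := ⟨T, h⟩

/-- orbit completeness: if the verdict is invariant under a group action on strata and holds on a set of
representatives meeting every orbit, it holds on every stratum. -/
theorem holds_everywhere_of_reps {G Stratum : Type*} [Group G] [MulAction G Stratum]
    (P : Stratum → Prop) (hinv : ∀ (g : G) σ, P σ → P (g • σ)) (R : Set Stratum)
    (hR : ∀ σ, ∃ ρ ∈ R, ∃ g : G, g • ρ = σ) (hP : ∀ ρ ∈ R, P ρ) : ∀ σ, P σ := by
  intro σ; obtain ⟨ρ, hρ, g, rfl⟩ := hR σ; exact hinv g ρ (hP ρ hρ)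

/-- one-sidedness of E2: from «no stratum fails under the universal cap» nothing follows about existence —
formally, a relaxation `R ≥ every table` with `R` good everywhere is consistent with no table being good. -/
theorem ub_pass_decides_nothing :
    ∃ (Table Stratum : Type) (Good : Table → Stratum → Prop) (GoodUB : Stratum → Prop),
      (∀ T σ, Good T σ → GoodUB σ) ∧ (∀ σ, GoodUB σ) ∧ ¬ ∃ T, ∀ σ, Good T σ :=
  ⟨Empty, Unit, fun _ _ => True, fun _ => True, fun _ _ _ => trivial, fun _ => trivial,
    fun ⟨T, _⟩ => T.elim⟩

/-! ## 6. Door universes quoted in the memo (numerals only) -/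
theorem key_count : 320 + 48 = 368 := by norm_num
theorem hubexit_faces : 120 + 560 + 1624 = 2304 := by norm_num

end HsemiregAlphabet.UnipotentExistArith
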